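/-
Copyright (c) 2026 the pub-hodgecm-mathlib formalisation cell (harness21).  Prover seat hodgecm-mathlib-B-p14 (g37), 2026-09-01.  Road «S3-tree» (architect A-p16 (g30) A-128 «swap»),
brick T3′ «depth-zero κ-transfer», population (P-2) TYPE (2), row (R2²) «THE FREE ROW», organ [T2-b] «THE GOOD CLASS HAS `κ = (−1)^n`» — its CARRIER-FREE KERNEL: the parity of a
symmetric eigenframe at a ramified quadratic extension (R2² holder A-p19 (g26), plan 19:17:00Z ¶ [T2-b]).
-/
import Mathlib.Topology.Algebra.Valued.ValuationTopology
import Mathlib.LinearAlgebra.Matrix.Determinant.Basic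
import Mathlib.RingTheory.MatrixAlgebra
import Mathlib.Algebra.Order.GroupWithZero.Canonical
import HarnessLib

/-!
# The parity of a symmetric eigenframe: `ι′(det P) = −det P`, anti-invariant elements have odd valuation, and the Gram determinant — the carrier-free kernel of
# «the good type-(2) class has `κ = (−1)^n`» (Rogawski 1990 Lemma 4.9.3; Jacobowitz 1962 §5, §7)

Topic `NumberTheory/Automorphic`; namespace `Literature.NumberTheory.Automorphic.SymmetricEigenframe`.  THEOREMS ONLY (no definition, no instance, no notation, no named fact, no
`sorry`); Mathlib-only, generic `[Field K] [Valued K ℤᵐ⁰]` ∕ `[CommRing R]`.  Cell `pub/hodgecm-mathlib` (D-0151), crux H413 = `stmt-HodgeConjecture-24833`; road «S3-tree», brick T3′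
«depth-zero κ-transfer», P-2 row (R2²) «THE FREE ROW, TYPE (2)» (holder A-p19 (g26); architect A-p16 (g30) A-127∕A-128), organ **[T2-b] «THE GOOD CLASS HAS `κ = (−1)^n`»**, its
carrier-free kernel (the CM layer over A-p19's [T2-c] carrier `K₁ = L_w(√disc χ_g)`, `σ̃`, `ι′` follows in the sequel).  HONEST LABEL: HC_CM is proved only modulo the 2 remaining named
inputs (hLiu418 24832, h413 24833) until rung 0 closes; elementary valuation ∕ determinant algebra, asserts nothing printed.

THE MATHEMATICS (A-p19 (g26) 19:17:00Z ¶ [T2-b]).  At a non-split place the type-(2) class `δ` has eigen-algebra `L_w × K₁` with `K₁ ∕ L_w` RAMIFIED quadratic (`v_w(disc χ_g) = 2N+1`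
odd), Galois involution `ι′`.  Over `K₁` the eigenframe is SYMMETRIC: `P = [x₀ | x₁ | ι′x₁]` with `x₀` rational, so `ι′(det P) = −det P` (§2: a column swap), hence `det P` is
ANTI-invariant and has ODD valuation (§1: `z·θ` is `ι′`-fixed for an anti-invariant `θ` of odd valuation, and `ι′`-fixed elements have even valuation at a ramified place); the
Gram matrix `ᵗ(σ̃P)·H·P = diag(d₀, d₁, d₂)` gives `|d₀ d₁ d₂| = |det P|²·|det H|` (§3), so with `|d₂| = |d₁|` (`d₂ = ι′d₁`) and `H` unimodular: `log|d₀| + 2·log|d₁| = 2·log|det P|`,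
i.e. `½·log|d₀| + log|d₁|` is ODD (§4).  With the criterion exponents `|s₀| = |χ_g(u)|` (`v_w = n`) and `v_{K₁}(s₁) = n + 2N + 1`, the two goodness parities «`v_w(d₀ s₀)` even» and
«`v_{K₁}(d₁ s₁)` even» COINCIDE and equal «`v_w(d₀) ≡ n (mod 2)`» = «`κ = (−1)^n`» (§4 `even_and_even_iff_of_odd_add`, pure arithmetic; κ is read on `d₀` by ★
`finKappaAt_eq_ite_of_eigenvector`).

* §1 **`odd_log_of_map_eq_neg`** — `ι z = −z`, `z ≠ 0` ⇒ `log|z|` odd (given: `ι`-fixed non-zero elements have even `log|·|`, one anti-invariant `θ` with odd `log|θ|`).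
* §2 **`map_det_eq_neg_det_of_cols`** — `ι` fixes column `0` and swaps columns `1, 2` entrywise ⇒ `ι(det M) = −det M` (any commutative ring, `Fin 3`); `det_ne_zero`-free.
* §3 **`v_prod_eq_of_gram_eq_diagonal`** — `ᵗ(M.map σ)·H·M = diagonal d`, `σ` isometric ⇒ `|∏ dᵢ| = |det M|²·|det H|` (any index type).
* §4 **`log_add_two_mul_log_eq_of_symmetric_frame`** (`log|d₀| + 2·log|d₁| = 2·log|det P| + log|det H|` for `Fin 3` with `|d₂| = |d₁|`), **`odd_half_log_add_log_of_symmetric_frame`**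
  (the parity conclusion under `|det H| = 1`), and the arithmetic close **`even_and_even_iff_of_odd_add`**.

## References
* [Rogawski1990] J. D. Rogawski, *Automorphic Representations of Unitary Groups in Three Variables* (1990), §4.9 Lemma 4.9.3 p. 56 (the lattice count by eigen-coordinates).
* [Jacobowitz1962] R. Jacobowitz, *Hermitian forms over local fields*, Amer. J. Math. 84 (1962), §5 (ramified case), §7 Thm. 7.1.
* [SerreLocalFields1979] J.-P. Serre, *Local Fields*, GTM 67 (1979), Ch. I §6 (totally ramified quadratic extensions: the fixed field has even valuations).
* [LanglandsShelstad1987] R. P. Langlands, D. Shelstad, *On the definition of transfer factors*, Math. Ann. 278 (1987), §1.3–1.4 (the sign `κ`).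
-/

set_option autoImplicit false

open Matrix
open scoped WithZero

namespace Literature.NumberTheory.Automorphic.SymmetricEigenframe

/-! ## §1 Anti-invariant elements of a ramified quadratic extension have odd valuation -/

section Valued

variable {K : Type*} [Field K] [Valued K ℤᵐ⁰]

/-- **Anti-invariant elements have ODD valuation** at a ramified quadratic place: if the `ι`-fixed non-zero elements have even `log`-valuation and some anti-invariant `θ`
(`ιθ = −θ`) has odd `log`-valuation, then every non-zero `z` with `ιz = −z` has odd `log`-valuation (`zθ` is `ι`-fixed). [cite: SerreLocalFields1979, Ch. I §6] [cite: Jacobowitz1962, §5] -/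
theorem odd_log_of_map_eq_neg (ι : K →+* K) (heven : ∀ x : K, x ≠ 0 → ι x = x → Even (WithZero.log (Valued.v x)))
    {θ : K} (hθ0 : θ ≠ 0) (hθ : ι θ = -θ) (hθodd : Odd (WithZero.log (Valued.v θ)))
    {z : K} (hz0 : z ≠ 0) (hz : ι z = -z) : Odd (WithZero.log (Valued.v z)) := by
  have hfix : ι (z * θ) = z * θ := by rw [map_mul, hz, hθ, neg_mul_neg]
  have hev := heven (z * θ) (mul_ne_zero hz0 hθ0) hfix
  rw [map_mul, WithZero.log_mul ((Valuation.ne_zero_iff _).2 hz0) ((Valuation.ne_zero_iff _).2 hθ0)] at hev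
  obtain ⟨k, hk⟩ := hev
  obtain ⟨m, hm⟩ := hθodd
  exact ⟨k - m - 1, by omega⟩

/-! ## §3 The Gram determinant: `|∏ dᵢ| = |det M|² · |det H|` -/

/-- **The Gram determinant**: if `ᵗ(M.map σ)·H·M = diagonal d` with `σ` valuation-preserving then `|∏ᵢ dᵢ| = |det M|²·|det H|`. [cite: Jacobowitz1962, §7 Thm. 7.1]
[cite: Rogawski1990, §4.9 Lemma 4.9.3 p. 56] -/
theorem v_prod_eq_of_gram_eq_diagonal (σ : K →+* K) (hσv : ∀ x, Valued.v (σ x) = Valued.v x) {n : Type*} [Fintype n] [DecidableEq n]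
    (H M : Matrix n n K) (d : n → K) (hG : (M.map σ)ᵀ * H * M = Matrix.diagonal d) :
    Valued.v (∏ i, d i) = Valued.v M.det ^ 2 * Valued.v H.det := by
  have hdet := congrArg Matrix.det hG
  rw [Matrix.det_mul, Matrix.det_mul, Matrix.det_transpose, ← RingHom.mapMatrix_apply, ← RingHom.map_det, Matrix.det_diagonal] at hdet
  rw [← hdet, map_mul, map_mul, hσv, sq, mul_right_comm]

/-- **The symmetric-frame identity** (`Fin 3`, `|d₂| = |d₁|`, all data non-zero): `log|d₀| + 2·log|d₁| = 2·log|det M| + log|det H|`. [cite: Rogawski1990, §4.9 Lemma 4.9.3 p. 56] -/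
theorem log_add_two_mul_log_eq_of_symmetric_frame (σ : K →+* K) (hσv : ∀ x, Valued.v (σ x) = Valued.v x)
    (H M : Matrix (Fin 3) (Fin 3) K) (d : Fin 3 → K) (hG : (M.map σ)ᵀ * H * M = Matrix.diagonal d)
    (hd0 : d 0 ≠ 0) (hd1 : d 1 ≠ 0) (hd12 : Valued.v (d 2) = Valued.v (d 1)) (hM : M.det ≠ 0) (hH : H.det ≠ 0) :
    WithZero.log (Valued.v (d 0)) + 2 * WithZero.log (Valued.v (d 1)) = 2 * WithZero.log (Valued.v M.det) + WithZero.log (Valued.v H.det) := by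
  have h := v_prod_eq_of_gram_eq_diagonal σ hσv H M d hG
  rw [Fin.prod_univ_three, map_mul, map_mul, hd12] at h
  have hv0 : Valued.v (d 0) ≠ 0 := (Valuation.ne_zero_iff _).2 hd0
  have hv1 : Valued.v (d 1) ≠ 0 := (Valuation.ne_zero_iff _).2 hd1
  have hvM : Valued.v M.det ≠ 0 := (Valuation.ne_zero_iff _).2 hM
  have hvH : Valued.v H.det ≠ 0 := (Valuation.ne_zero_iff _).2 hH
  have hlog := congrArg WithZero.log h
  rw [WithZero.log_mul (mul_ne_zero hv0 hv1) hv1, WithZero.log_mul hv0 hv1, WithZero.log_mul (pow_ne_zero 2 hvM) hvH, WithZero.log_pow] at hlog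
  -- `hlog : log d₀ + log d₁ + log d₁ = 2 • log det M + log det H`
  simp only [nsmul_eq_mul, Nat.cast_ofNat] at hlog
  linarith

/-- **THE PARITY OF A SYMMETRIC EIGENFRAME**: in the situation of `log_add_two_mul_log_eq_of_symmetric_frame` with `H` unimodular (`|det H| = 1`) and `det M` of ODD `log`-valuation
(`odd_log_of_map_eq_neg` ∘ `map_det_eq_neg_det_of_cols`): `log|d₀|` is even and `½·log|d₀| + log|d₁|` is ODD. [cite: Rogawski1990, §4.9 Lemma 4.9.3 p. 56] [cite: Jacobowitz1962, §5] -/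
theorem odd_half_log_add_log_of_symmetric_frame (σ : K →+* K) (hσv : ∀ x, Valued.v (σ x) = Valued.v x)
    (H M : Matrix (Fin 3) (Fin 3) K) (d : Fin 3 → K) (hG : (M.map σ)ᵀ * H * M = Matrix.diagonal d)
    (hd0 : d 0 ≠ 0) (hd1 : d 1 ≠ 0) (hd12 : Valued.v (d 2) = Valued.v (d 1)) (hH : Valued.v H.det = 1) (hM : Odd (WithZero.log (Valued.v M.det))) :
    Even (WithZero.log (Valued.v (d 0))) ∧ Odd (WithZero.log (Valued.v (d 0)) / 2 + WithZero.log (Valued.v (d 1))) := by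
  have hM0 : M.det ≠ 0 := by
    intro h0
    rw [h0, map_zero, WithZero.log_zero] at hM
    exact (Int.not_odd_iff_even.2 (by decide : Even (0 : ℤ))) hM
  have hH0 : H.det ≠ 0 := fun h0 => by rw [h0, map_zero] at hH; exact zero_ne_one hH
  have h := log_add_two_mul_log_eq_of_symmetric_frame σ hσv H M d hG hd0 hd1 hd12 hM0 hH0
  rw [hH, WithZero.log_one, add_zero] at h
  obtain ⟨m, hm⟩ := hM
  refine ⟨⟨m + m + 1 - WithZero.log (Valued.v (d 1)), by omega⟩, ⟨m, by omega⟩⟩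

end Valued

/-! ## §2 The determinant of a symmetric frame is anti-invariant -/

section Det

variable {R : Type*} [CommRing R]

/-- **`ι(det M) = −det M` for a symmetric frame** `M = [c₀ | c₁ | ι c₁]`: a ring endomorphism `ι` fixing column `0` entrywise and exchanging columns `1` and `2` entrywise maps
`det M` to `−det M` (`M.map ι` is `M` with two columns swapped). [cite: Rogawski1990, §4.9 Lemma 4.9.3 p. 56] -/
theorem map_det_eq_neg_det_of_cols (ι : R →+* R) (M : Matrix (Fin 3) (Fin 3) R)
    (h0 : ∀ i, ι (M i 0) = M i 0) (h1 : ∀ i, ι (M i 1) = M i 2) (h2 : ∀ i, ι (M i 2) = M i 1) :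
    ι M.det = -M.det := by
  have hmap : ι.mapMatrix M = M.submatrix id (Equiv.swap (1 : Fin 3) 2) := by
    ext i j
    rw [RingHom.mapMatrix_apply, Matrix.map_apply, Matrix.submatrix_apply]
    fin_cases j
    · show ι (M i 0) = M i ((Equiv.swap (1 : Fin 3) 2) 0)
      rw [Equiv.swap_apply_of_ne_of_ne (by decide) (by decide)]; exact h0 i
    · show ι (M i 1) = M i ((Equiv.swap (1 : Fin 3) 2) 1)
      rw [Equiv.swap_apply_left]; exact h1 i
    · show ι (M i 2) = M i ((Equiv.swap (1 : Fin 3) 2) 2)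
      rw [Equiv.swap_apply_right]; exact h2 i
  rw [RingHom.map_det, hmap, Matrix.det_permute', Equiv.Perm.sign_swap (by decide : (1 : Fin 3) ≠ 2)]
  simp

end Det

/-! ## §4 The arithmetic close: the two goodness parities coincide -/

/-- **The two goodness parities coincide**: for integers `a₀, a₁` (the `log`-valuations of `d₀` over `L_w` and of `d₁` over `K₁`) with `a₀ + a₁` ODD, and criterion exponents `e₀ = n`,
`e₁ = n + 2N + 1`: `(a₀ + e₀` even ∧ `a₁ + e₁` even`) ↔ `a₀ + n` even — «the good class is the one with `κ = (−1)^n`». [cite: Rogawski1990, §4.9 Lemma 4.9.3 p. 56]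
[cite: LanglandsShelstad1987, §1.3–1.4] -/
theorem even_and_even_iff_of_odd_add {a₀ a₁ n N : ℤ} (hodd : Odd (a₀ + a₁)) :
    (Even (a₀ + n) ∧ Even (a₁ + (n + 2 * N + 1))) ↔ Even (a₀ + n) := by
  obtain ⟨m, hm⟩ := hodd
  constructor
  · exact fun h => h.1
  · rintro ⟨k, hk⟩
    exact ⟨⟨k, hk⟩, ⟨m + N - k + n + 1, by omega⟩⟩

end Literature.NumberTheory.Automorphic.SymmetricEigenframe
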